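import Summits.ResolutionOfSingularities.ResolutionOfSingularities.Theorems.WeightedInvariantGermContractionChart
import Literature.AlgebraicGeometry.Resolution.CotangentIndependenceSpread
import HarnessLib

/-!
# A weighted chart on an open subscheme, read on the ambient scheme

Route `ResolutionOfSingularities/WeightedInvariant`, door crux `HypersurfaceCentreConstruction`
(stmt-ResolutionOfSingularities-19897) — OURS, helper; e-ladder `e = 1`, registered stub `stub_e1_centre` of
`res-L1-w43-stub-10` (cell res-hironaka, `D/res-D-pv-025/DOOR-ELADDER-PLAN.md` §8, assembly step **A2/A5**).

The vendored Abramovich–Quek–Schober fact hands the centre at a maximal singular point `η` as a Rees algebra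
`R` on an OPEN `V ∋ η` of the ambient `Y`, with a weighted chart `(U, u, w)` on an affine open `U` of the open
SUBSCHEME `V`.  The e-ladder works on `Y`.  This file reads the chart on `Y`: the affine open `V.ι ''ᵁ U` of
`Y` has the same sections (`Scheme.Opens.toScheme_presheaf_obj`, definitional), the stalks correspond along
`Scheme.Opens.stalkIso`, compatibly with germs (`stalkIso_hom_germ`), so

* `germ_image_mem_maximalIdeal_iff` — a section vanishes at a point of `V` iff it vanishes at its image;
* `linearIndependent_toCotangent_image_of_isWeightedChart` — the chart clause «the `uᵢ` are part of a regular
  system of parameters at every common zero» holds for the `Y`-stalks (transport along the stalk isomorphism,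
  `linearIndependent_toCotangent_map_ringEquiv`);
* `mem_closure_image_of_isWeightedChart` — if `R.support = closure {η}` in `V`, every common zero of the `uᵢ`
  in `V.ι ''ᵁ U` lies in the closure of `η` in `Y`;
* `germContractionIdeal_image_eq_piece_ideal` — consequently (file `…GermContractionChart`, L0-η) the ideal of
  `Γ(Y, V.ι ''ᵁ U) = Γ(V, U)` contracted from the germ piece `𝒥ₙ(germ u; w) ⊆ 𝒪_{Y,η}` IS the chart piece
  `Rₙ(U)`, provided the stalks of `Y` are regular (smooth over a field) — the comparison `hRP` consumed by the
  drop transport (`…ELadderOneDropTransport`) and the identification of the orbit centre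
  `ReesAlgebraData.ofGermFiltration η 𝒥∙` with the vendored one near `η`.

Def-free; no named facts; nothing here is a claim about Hironaka's problem.  AI-written; weaker than expert
review.
-/

noncomputable section

set_option linter.dupNamespace false -- mandated namespace of this single-conjunct summit

namespace Summit.ResolutionOfSingularities.ResolutionOfSingularities.Theorems

universe u

open CategoryTheory AlgebraicGeometry TopologicalSpace IsLocalRing Opposite
open Literature.AlgebraicGeometry.Resolution

variable {Y : Scheme.{u}} (V : Y.Opens)

/-! ## Germs along an open subscheme -/

/-- **Germs along an open subscheme**: the stalk isomorphism `𝒪_{V,x} ≅ 𝒪_{Y,x}` of the open subscheme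
`V ⊆ Y` sends the germ at `x` of a section `s ∈ Γ(V, W) = Γ(Y, V.ι ''ᵁ W)` to its germ at `x` in `Y`
(elementwise `Scheme.Opens.germ_stalkIso_hom`). [folklore] -/
theorem stalkIso_hom_germ (W : (V : Scheme.{u}).Opens) (x : (V : Scheme.{u})) (hx : x ∈ W) (s : Γ(V, W)) :
    (V.stalkIso x).hom.hom (((V : Scheme.{u}).presheaf.germ W x hx).hom s) =
      (Y.presheaf.germ (V.ι ''ᵁ W) x.1 ⟨x, hx, rfl⟩).hom s := by
  rw [← V.germ_stalkIso_hom x hx]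
  rfl

/-- A germ on the open subscheme lies in the maximal ideal iff its image germ on `Y` does. [folklore] -/
theorem germ_image_mem_maximalIdeal_iff (W : (V : Scheme.{u}).Opens) (x : (V : Scheme.{u})) (hx : x ∈ W) (s : Γ(V, W)) :
    (Y.presheaf.germ (V.ι ''ᵁ W) x.1 ⟨x, hx, rfl⟩).hom s ∈ maximalIdeal (Y.presheaf.stalk x.1) ↔
      ((V : Scheme.{u}).presheaf.germ W x hx).hom s ∈ maximalIdeal ((V : Scheme.{u}).presheaf.stalk x) := by
  rw [← stalkIso_hom_germ V W x hx s, mem_maximalIdeal, mem_maximalIdeal, mem_nonunits_iff, mem_nonunits_iff,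
    not_iff_not]
  constructor
  · intro h
    have h' := h.map (V.stalkIso x).inv.hom
    rwa [← RingHom.comp_apply, ← CommRingCat.hom_comp, Iso.hom_inv_id, CommRingCat.hom_id,
      RingHom.id_apply] at h'
  · intro h
    exact h.map _

/-- A point of the open subscheme is a common zero of sections `uᵢ ∈ Γ(V, W)` iff its image in `Y` is.
[folklore] -/
theorem forall_germ_image_mem_maximalIdeal_iff (W : (V : Scheme.{u}).Opens) (x : (V : Scheme.{u})) (hx : x ∈ W) {m : ℕ}
    (u : Fin m → Γ(V, W)) :
    (∀ i, (Y.presheaf.germ (V.ι ''ᵁ W) x.1 ⟨x, hx, rfl⟩).hom (u i) ∈ maximalIdeal (Y.presheaf.stalk x.1)) ↔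
      ∀ i, ((V : Scheme.{u}).presheaf.germ W x hx).hom (u i) ∈
        maximalIdeal ((V : Scheme.{u}).presheaf.stalk x) :=
  forall_congr' fun i => germ_image_mem_maximalIdeal_iff V W x hx (u i)

/-! ## The chart clauses, read on `Y` -/

variable {V}
variable {R : ReesAlgebraData (V : Scheme.{u})} {U : (V : Scheme.{u}).affineOpens} {m : ℕ}
  {u : Fin m → Γ(V, U)} {w : Fin m → ℕ}

/-- **Regular parameters stay regular parameters along the stalk isomorphism.**  For a weighted chart
`(U, u, w)` of a Rees algebra on the open subscheme `V ⊆ Y` and a point `y` of the affine open `V.ι ''ᵁ U`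
of `Y` at which all `uᵢ` vanish, the classes of the `Y`-germs of the `uᵢ` in `𝔪_y/𝔪_y²` are linearly
independent. [folklore] -/
theorem linearIndependent_toCotangent_image_of_isWeightedChart (h : R.IsWeightedChart U u w) (y : Y)
    (hy : y ∈ V.ι ''ᵁ (U : (V : Scheme.{u}).Opens))
    (hvan : ∀ i, (Y.presheaf.germ (V.ι ''ᵁ (U : (V : Scheme.{u}).Opens)) y hy).hom (u i) ∈
      maximalIdeal (Y.presheaf.stalk y)) :
    LinearIndependent (ResidueField (Y.presheaf.stalk y))
      (fun i => (maximalIdeal (Y.presheaf.stalk y)).toCotangent ⟨_, hvan i⟩) := by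
  obtain ⟨x, hxU, rfl⟩ := hy
  have hvanV : ∀ i, ((V : Scheme.{u}).presheaf.germ (U : (V : Scheme.{u}).Opens) x hxU).hom (u i) ∈
      maximalIdeal ((V : Scheme.{u}).presheaf.stalk x) :=
    (forall_germ_image_mem_maximalIdeal_iff V U x hxU u).mp hvan
  have hliV := h.linearIndependent x hxU hvanV
  let e : (V : Scheme.{u}).presheaf.stalk x ≃+* Y.presheaf.stalk x.1 := (V.stalkIso x).commRingCatIsoToRingEquiv
  have he : ∀ i, e (((V : Scheme.{u}).presheaf.germ (U : (V : Scheme.{u}).Opens) x hxU).hom (u i)) =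
      (Y.presheaf.germ (V.ι ''ᵁ (U : (V : Scheme.{u}).Opens)) x.1 ⟨x, hxU, rfl⟩).hom (u i) := fun i =>
    stalkIso_hom_germ V U x hxU (u i)
  have hex : ∀ i, e (((V : Scheme.{u}).presheaf.germ (U : (V : Scheme.{u}).Opens) x hxU).hom (u i)) ∈
      maximalIdeal (Y.presheaf.stalk x.1) := fun i => (he i).symm ▸ hvan i
  have hli := linearIndependent_toCotangent_map_ringEquiv e _ hvanV hliV hex
  have hfun : (fun i => (maximalIdeal (Y.presheaf.stalk x.1)).toCotangent
      ⟨e (((V : Scheme.{u}).presheaf.germ (U : (V : Scheme.{u}).Opens) x hxU).hom (u i)), hex i⟩) =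
      (fun i => (maximalIdeal (Y.presheaf.stalk x.1)).toCotangent ⟨_, hvan i⟩) := by
    funext i
    congr 1
    exact Subtype.ext (he i)
  rw [hfun] at hli
  exact hli

/-- **Common zeros lie in the orbit closure.**  If moreover `R.support = closure {η}` in `V`, every point of
`V.ι ''ᵁ U` at which all `uᵢ` vanish lies in the closure of `η` in `Y` (`IsWeightedChart.mem_support_iff` on
`V`, then continuity of `V.ι`). [folklore] -/
theorem mem_closure_image_of_isWeightedChart (h : R.IsWeightedChart U u w) {η : (V : Scheme.{u})}
    (hsupp : R.support = closure ({η} : Set (V : Scheme.{u}))) (y : Y) (hy : y ∈ V.ι ''ᵁ (U : (V : Scheme.{u}).Opens))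
    (hvan : ∀ i, (Y.presheaf.germ (V.ι ''ᵁ (U : (V : Scheme.{u}).Opens)) y hy).hom (u i) ∈
      maximalIdeal (Y.presheaf.stalk y)) :
    y ∈ closure ({η.1} : Set Y) := by
  obtain ⟨x, hxU, rfl⟩ := hy
  have hvanV : ∀ i, ((V : Scheme.{u}).presheaf.germ (U : (V : Scheme.{u}).Opens) x hxU).hom (u i) ∈
      maximalIdeal ((V : Scheme.{u}).presheaf.stalk x) :=
    (forall_germ_image_mem_maximalIdeal_iff V U x hxU u).mp hvan
  have hxsupp : x ∈ R.support := by
    rw [ReesAlgebraData.IsWeightedChart.mem_support_iff R h hxU]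
    intro i hi
    rw [(V : Scheme.{u}).mem_basicOpen (u i) x hxU] at hi
    exact (mem_maximalIdeal _).mp (hvanV i) hi
  rw [hsupp] at hxsupp
  have himg : (x.1 : Y) ∈ (fun z : (V : Scheme.{u}) => (z.1 : Y)) '' closure ({η} : Set (V : Scheme.{u})) := ⟨x, hxsupp, rfl⟩
  have hsub : (fun z : (V : Scheme.{u}) => (z.1 : Y)) '' closure ({η} : Set (V : Scheme.{u})) ⊆ closure ({η.1} : Set Y) := by
    refine (image_closure_subset_closure_image continuous_subtype_val).trans (closure_mono ?_)
    rintro _ ⟨z, hz, rfl⟩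
    obtain rfl : z = η := hz
    exact Set.mem_singleton _
  exact hsub himg

/-- **L0-η on the image chart**: for a weighted chart `(U, u, w)` of `R` on the open subscheme `V ∋ η` with
`R.support = closure {η}`, on an ambient `Y` all of whose local rings are regular, the ideal of
`Γ(Y, V.ι ''ᵁ U) = Γ(V, U)` contracted from the germ piece `𝒥ₙ(germ_η u; w) ⊆ 𝒪_{Y,η}` is the chart piece
`Rₙ(U)` — for every `n`. [folklore] -/
theorem germContractionIdeal_image_eq_piece_ideal (hreg : ∀ y : Y, IsRegularLocalRing (Y.presheaf.stalk y))
    (h : R.IsWeightedChart U u w) {η : (V : Scheme.{u})} (hηU : η ∈ (U : (V : Scheme.{u}).Opens))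
    (hsupp : R.support = closure ({η} : Set (V : Scheme.{u}))) (n : ℕ) :
    germContractionIdeal η.1
        (weightedMonomialIdeal
          (fun i => (Y.presheaf.germ (V.ι ''ᵁ (U : (V : Scheme.{u}).Opens)) η.1 ⟨η, hηU, rfl⟩).hom (u i)) w n)
        ⟨V.ι ''ᵁ (U : (V : Scheme.{u}).Opens), U.2.image_of_isOpenImmersion V.ι⟩ =
      (R.piece n).ideal U := by
  rw [h.ideal_eq n]
  -- the parameters vanish at `η`: `η ∈ R.support`
  have hηsupp : η ∈ R.support := by
    rw [hsupp]
    exact subset_closure (Set.mem_singleton η)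
  have hvanV : ∀ i, ((V : Scheme.{u}).presheaf.germ (U : (V : Scheme.{u}).Opens) η hηU).hom (u i) ∈
      maximalIdeal ((V : Scheme.{u}).presheaf.stalk η) := by
    intro i
    have hi := (ReesAlgebraData.IsWeightedChart.mem_support_iff R h hηU).mp hηsupp i
    rw [(V : Scheme.{u}).mem_basicOpen (u i) η hηU] at hi
    exact (mem_maximalIdeal _).mpr hi
  have hvan : ∀ i, (Y.presheaf.germ (V.ι ''ᵁ (U : (V : Scheme.{u}).Opens)) η.1 ⟨η, hηU, rfl⟩).hom (u i) ∈
      maximalIdeal (Y.presheaf.stalk η.1) :=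
    (forall_germ_image_mem_maximalIdeal_iff V U η hηU u).mpr hvanV
  exact germContractionIdeal_weightedMonomialIdeal_germ_eq
    ⟨V.ι ''ᵁ (U : (V : Scheme.{u}).Opens), U.2.image_of_isOpenImmersion V.ι⟩ u w ⟨η, hηU, rfl⟩ h.w_pos hvan
    (fun y hy hv => mem_closure_image_of_isWeightedChart h hsupp y hy hv) (fun y _ _ => hreg y)
    (fun y hy hv => linearIndependent_toCotangent_image_of_isWeightedChart h y hy hv) n

end Summit.ResolutionOfSingularities.ResolutionOfSingularities.Theorems

end
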